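import Literature.MathematicalPhysics.QuantumFieldTheory.Balaban1983to89.B5Phi162Torus
import Literature.MathematicalPhysics.QuantumFieldTheory.Balaban1983to89.B5HkPropsTorus

/-!
# Bałaban 1984 (Propagators I), Sect. D p.27–29: the operator `H_k` in x-space, (1.59)/(1.60), on
the double torus — its printed properties, and (1.60) = (1.63)

T. Bałaban, *Propagators and renormalization transformations for lattice gauge theories. I*,
Commun. Math. Phys. **95** (1984) 17–40, Sect. D «The case of τ = 1 (the δ-function constraint)»,
pp. 27–29 [PDF 11–13].  Quotations below are read from the page images
(`1984-cmp95-propagators-rt-I-p011-x2.png`, `-p012-x2.png`, `-p013-x2.png`), not from OCR.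

PRINTED (p.27): «Substituting it into the other two equations in (1.49) and using the identity
  Q_k∂ = ∂₁Q′_k,                                                                     (1.55)
∂₁ is the unit lattice differentiation, we get …» — «It implies that B − Q_kA₀ is orthogonal to
constant functions. Taking the decomposition B = B′ + B₀, where B₀ is a constant configuration and
B′ is in the orthogonal subspace, we can identify Q_kA₀ = B₀, or A₀ = Q_k*B₀.» — «Let us introduce
the operator
  φ = Q_kΔ⁻¹Q_k*.                                                                    (1.58)
Equation (1.57) can be solved with respect to ω and we get ω = + φ⁻¹∂₁λ′ − φ⁻¹B′. The solvability
condition gives the equation ∂₁*ω = ∂₁*φ⁻¹∂₁λ′ − ∂₁*φ⁻¹B′ = 0. This equation can be solved with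
respect to λ′, and we get λ′ = (∂₁*φ⁻¹∂₁)⁻¹∂₁*φ⁻¹B′. These calculations lead to the following result
for the minimal configuration A, i.e. for the solution of Eq.. (1.49):»
(p.28) «A = Δ⁻¹Q_k*(φ⁻¹B′ − φ⁻¹∂₁(∂₁*φ⁻¹∂₁)⁻¹∂₁*φ⁻¹B′)
          + ∂Δ⁻²Q′_k*(Q′_kΔ⁻²Q′_k*)⁻¹(∂₁*φ⁻¹∂₁)⁻¹∂₁*φ⁻¹B′ + Q_k*B₀.                    (1.59)
This defines the operator H_kB = A, thus we have
  H_kB = Δ⁻¹Q_k*φ⁻¹B′ + [∂Δ⁻²Q′_k*(Q′_kΔ⁻²Q′_k*)⁻¹ − Δ⁻¹Q_k*φ⁻¹∂₁]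
           ·(∂₁*φ⁻¹∂₁)⁻¹∂₁*φ⁻¹B′ + Q_k*B₀.                                          (1.60)
Let us write this operator in momentum representation. … We have the following momentum
representation for H_kB: … (1.63)»
(p.29) «Using (1.60), or better (1.63), we can verify all the properties of H_kB: Q_kH_kB = B,
R∂*H_kB = 0, H_kB is a minimum of ½⟨∂A, ∂A⟩ on the hyperplane {A : Q_kA = B, R∂*A = 0}, which
means that ⟨∂A′, ∂H_kB⟩ = 0 on the subspace {A′ : Q_kA′ = 0, R∂*A′ = 0}.»

WHAT THIS FILE DOES (kernel-checked bookkeeping on the finite double torus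
`T_η = Tor (fine n M)`, `T₁^{(k)} = Tor M`, `n = L^k`, lattice constant `c = n` on `T_η` and `c = 1`
on the unit lattice, as everywhere in the B5 tree modules; NOT summit progress):

* §1–§2 tools: scalar Fourier multipliers `sMul`, the symbol of the componentwise `Δ`
  (`dft_comp_Lap`), constant configurations `constV`, the decomposition `B = B′ + B₀`
  (`Bp`, `B0`, the orthogonal projection onto constant configurations `P0M`), and THE CONCRETE
  OPERATOR LAWS behind p.29 — proved here for the torus operators, where pass pv15's
  `B5HkProperties.OpData.Laws` ASSUMES them of abstract ones: `∂*Δ⁻¹ = Δ⁻¹∂*` (`divS_LapVinv`);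
  `ΔΔ⁻¹ = I` on fields orthogonal to constants (`Lap_LapVinv_of_orthConst`); `Δ∂ = ∂Δ` hence
  `∂*∂·∂ = (Δ − ∂∂*)∂ = 0` (`DstarD_GradOp_mulVec`); «Q_kA₀ = B₀, or A₀ = Q_k*B₀» for constant `B₀`
  (`QvAdj_constV`, `QvOp_constV`: `Q_k*B₀` IS the constant configuration on `T_η` with the same
  components, and `Q_k` of it is `B₀`); `(Δ − ∂∂*)A₀ = 0`, `∂*A₀ = 0` for constant `A₀`.
* §3 (1.55) `Q_k∂ = ∂₁Q′_k` (`QvOp_GradOp_mulVec`, from `B5Block118.QvOp_gaugeT_eq`) and its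
  (1.21)-adjoint `∂*Q_k* = Q′_k*∂₁*` (`divS_QvAdj`); `Q′_k* = QsAdj`, `(Q′_kΔ⁻²Q′_k*)⁻¹ = Einv`.
* §4 THE PRINTED `(∂₁*φ⁻¹∂₁)⁻¹` and `λ′`: `GPhi := (∂₁)ᴴ·φ⁻¹·∂₁` (with g12's `PhiInv`, the printed
  `φ⁻¹` on the subspace orthogonal to constants) is the unit-lattice scalar Fourier multiplier
  `g(p′) = Σ_μ |∂¹_μ(p′)|² φ_μ(p′)⁻¹` (`dft_GPhi`), positive for `p′ ≠ 0` (`gsym_ne_zero`, from pv15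
  `phi162_pos` via g12 `phi162_sOf_pos`); `GPhiInv` = the multiplier `g⁻¹` (value `0` at `p′ = 0`) is
  its inverse on scalars orthogonal to constants (`GPhi_GPhiInv_of_orth`); `Lam B := λ′ =
  (∂₁*φ⁻¹∂₁)⁻¹∂₁*φ⁻¹B′` and THE PRINTED SOLVABILITY/NORMAL EQUATION «∂₁*ω = ∂₁*φ⁻¹∂₁λ′ − ∂₁*φ⁻¹B′
  = 0» for it (`normal_eq`, `divS1_omegaW`), together with (1.57) «−Q_kΔ⁻¹Q_k*ω + ∂₁λ′ + Q_kA₀ = B»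
  for the printed `ω = φ⁻¹∂₁λ′ − φ⁻¹B′`, `A₀ = Q_k*B₀` (`eq157`).
* §5 THE TYPED (1.59) AND (1.60): `H159 n M B` and `H160 n M B` verbatim in the printed groupings
  (`Δ⁻¹ = LapVinv`, `Q_k* = QvAdj`, `φ⁻¹ = PhiInv`, `∂ = GradOp (fine n M) n`, `∂₁ = GradOp M 1`,
  `Δ⁻² = LapSinv·LapSinv`, `Q′_k* = QsAdj = n^d•(QsOp)ᴴ`, `(Q′_kΔ⁻²Q′_k*)⁻¹ = Einv = n^{-d}•Minv`),
  «thus we have» `H159 = H160` (`H159_eq_H160`, linearity), and the regrouping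
  `H_kB = A* + ∂θ + Q_k*B₀` with `A* = Δ⁻¹Q_k*φ⁻¹(B′ − ∂₁λ′)`, `θ = Δ⁻²Q′_k*(Q′_kΔ⁻²Q′_k*)⁻¹λ′`.
* §6 THE THREE PRINTED p.29 PROPERTIES PROVED FOR (1.60) («Using (1.60) … we can verify all the
  properties of H_kB»): `QvOp_H160` (`Q_kH_kB = B`), `R_divS_H160` (`R∂*H_kB = 0`, `R = I − P`,
  `P = B5Value126.PcT`), `DstarD_H160` (`∂*∂H_kB = Q_k*φ⁻¹(B′ − ∂₁λ′)`), `form_DstarD_H160_eq_zero`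
  (the «which means that» clause `⟨A′, ∂*∂H_kB⟩ = 0` for every `A′` with `Q_kA′ = 0`) and
  `H160_minimum` (`cEnergy (H_kB) ≤ cEnergy A` whenever `Q_kA = B`); bundled as the typed verbatim
  sentence `B5.HkPropsPrinted` for the torus data of `B5HkPropsTorus.hkDataTorus` with `H := H160`
  (`hkPropsPrinted_H160`); and `H160_unique` (on the printed hyperplane the minimiser is unique).
* §7 **(1.60) = (1.63)**: `H160_eq_HkOp : H160 n M B = B5Hk163Torus.HkOp n M *ᵥ B` for every `B`,
  and as an operator identity `H160M n M = HkOp n M` — by g12's uniqueness theorem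
  `B5HkPropsTorus.eq_HkOp_of_hkPropsPrinted` (the printed properties determine `H_k` on the torus),
  i.e. the printed passage from (1.60) to «the following momentum representation for H_kB» (1.63)
  is certified WITHOUT retracing the symbol computation: both operators satisfy the p.29 sentence,
  and the sentence has exactly one solution.

HONEST SCOPE.  Certified: the algebra of pp.27–29 quoted above, for the tree's typed operators on
the finite double torus, and the identity of the x-space operator (1.60) with the tree's (1.63)
operator `HkOp`.  NOT claimed: (a) the derivation (1.50)–(1.57) of (1.59) from the Lagrange system
(1.49) is not retraced line by line — instead the variational content is certified directly (p.29:
`H_kB` is THE minimiser on the printed hyperplane, `B5HkPropsTorus.hk_unique`), and of the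
multiplier equations only (1.57) and «∂₁*ω = 0» are typed, for the printed `ω`, `λ′`, `A₀`;
(b) no bound (`γ₀`, `γ₁`, (1.66)–(1.67)) and no `L′_μ → ∞` / continuum statement; (c) `Δ⁻¹`, `φ⁻¹`,
`(Q′_kΔ⁻²Q′_k*)⁻¹`, `(∂₁*φ⁻¹∂₁)⁻¹` are the tree's inverses ON THE SUBSPACES ORTHOGONAL TO CONSTANTS
(value `0`, resp. `B5Substitution125.Minv`, on constants) — which is how the paper uses them, and
every argument they receive inside (1.60) is certified to lie in that subspace (`orthConst_Bp`,
`orthConst_Bpp`, `orthConst_QvAdj`, `sum_Lam`, `sum_divS`).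

Schematic choices (DIVERGENCE): finite double torus for `T_η`, `T₁^{(k)}`; `∂₁ = GradOp M 1` (unit
lattice constant, as in `B5Block118.QvOp_gaugeT_eq`); adjoints for the weighted scalar products
(1.21): `Q_k* = n^d•Q_kᴴ` (`B5DeltaA169.QvAdj`, fixed by (1.74)), `Q′_k* = n^d•Q′_kᴴ` (`QsAdj`),
`∂* = ∂ᴴ`, `∂₁* = ∂₁ᴴ` (equal weights on both sides); since `B5Substitution125.Mop` types
`Q′_kΔ⁻²Q′_kᴴ`, the printed `Q′_kΔ⁻²Q′_k*` is `n^d•Mop` and its inverse on the orthogonal complement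
of constants is `Einv := n^{-d}•Minv`; the product `Q′_k*(Q′_kΔ⁻²Q′_k*)⁻¹ = Q′_kᴴ·Minv` carries no
normalisation at all (`QsAdj_Einv`), so (1.60) is insensitive to this choice.

ABSOLUTE-RULE CENSUS: every theorem below is proved outright (sorry-free) from the tree modules
`B5Phi162Torus` (g12: `PhiOp`, `PhiInv`, `LapVinv`, `cMul`, `OrthConst`), `B5HkPropsTorus` (g12:
`hkDataTorus`, `eq_HkOp_of_hkPropsPrinted`), `B5Hk163RDiv`/`B5Hk164Transl` (`DstarD`, `cEnergy`),
`B5Block118`, `B5Action121`, `B5DeltaA169`, `B5Adjoint176`, `B5LaplaceInverse`, `B5Momentum130/133`,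
`B5Substitution125`, `B5Value126`, `B5DivOrth`, `B5FiberDelta`, `B5Bounds167Lattice` and Mathlib;
no statement of the paper enters as a hypothesis; `[cite:]` tags mark printed TEXT locations only.
Provenance: speedrun cell `pub-balaban`, paper sub-cell B05, lineage b05 gen 13.

v1.1 (lineage b05 gen 13; DOCSTRING-ONLY, no declaration changed): cross-read D1 (ref6) — the two
text locators of `H159_eq_HkOp`, `H160M_eq_HkOp` now read «(1.63) p.28»: (1.63) is printed at the
bottom of p.28 (render `-p012-x2.png`), as the header and `H160_eq_HkOp` already said.
-/

open scoped BigOperators Matrix ComplexConjugate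
open Finset Complex

namespace Literature.MathematicalPhysics.QuantumFieldTheory.Balaban1983to89.B5Hk160Torus

open Literature.MathematicalPhysics.QuantumFieldTheory.Balaban1983to89
open Literature.MathematicalPhysics.QuantumFieldTheory.Balaban1983to89.B5 (HkData HkPropsPrinted)
open Literature.MathematicalPhysics.QuantumFieldTheory.Balaban1983to89.B5Prop11Plancherel (Tor dft fine sOf
  sOf_zero dftV)
open Literature.MathematicalPhysics.QuantumFieldTheory.Balaban1983to89.B5Prop11Lower (Lap)
open Literature.MathematicalPhysics.QuantumFieldTheory.Balaban1983to89.B5Action121 (comp sdiff LapS GradOp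
  divS gaugeT Lap_eq_LapV GradOp_conjTranspose_mul_GradOp GradOp_conjTranspose_mulVec_eq
  sdiff_conjTranspose_mulVec star_mulVec_dotProduct)
open Literature.MathematicalPhysics.QuantumFieldTheory.Balaban1983to89.B5Block118 (QsOp QvOp cT QvOp_mulVec
  lineSum QvOp_gaugeT_eq)
open Literature.MathematicalPhysics.QuantumFieldTheory.Balaban1983to89.B5LaplaceInverse (ssym lsym LapSinv
  dft_mul_conjTranspose)
open Literature.MathematicalPhysics.QuantumFieldTheory.Balaban1983to89.B5Momentum130 (dft_zero_apply
  lsym_zero lsym_eq_zero_iff dft_LapS_apply)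
open Literature.MathematicalPhysics.QuantumFieldTheory.Balaban1983to89.B5Momentum133 (dft_LapSinv_apply)
open Literature.MathematicalPhysics.QuantumFieldTheory.Balaban1983to89.B5DeltaA169 (QvAdj QvAdj_mulVec
  QvAdj_adjoint dft_comp_GradOp dft_GradOp_adjoint)
open Literature.MathematicalPhysics.QuantumFieldTheory.Balaban1983to89.B5Adjoint176 (dft_QvOp_adjoint
  QvOp_adjoint_mulVec)
open Literature.MathematicalPhysics.QuantumFieldTheory.Balaban1983to89.B5Substitution125 (Mop Minv Mop_mulVec
  Mop_Minv_of_orth)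
open Literature.MathematicalPhysics.QuantumFieldTheory.Balaban1983to89.B5Value126 (PcT PcT_mulVec
  LapS_LapSinv_LapSinv)
open Literature.MathematicalPhysics.QuantumFieldTheory.Balaban1983to89.B5DivOrth (sum_divS)
open Literature.MathematicalPhysics.QuantumFieldTheory.Balaban1983to89.B5FiberDelta (dftV_mul_LapV)
open Literature.MathematicalPhysics.QuantumFieldTheory.Balaban1983to89.B5Hk163Torus (HkOp
  dft_mulVec_injective)
open Literature.MathematicalPhysics.QuantumFieldTheory.Balaban1983to89.B5Hk163RDiv (DstarD DstarD_conjTranspose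
  HkOp_minimum_unique)
open Literature.MathematicalPhysics.QuantumFieldTheory.Balaban1983to89.B5Hk164Transl (cEnergy cEnergy_nonneg)
open Literature.MathematicalPhysics.QuantumFieldTheory.Balaban1983to89.B5HkPropsTorus (hkDataTorus
  eq_HkOp_of_hkPropsPrinted)
open Literature.MathematicalPhysics.QuantumFieldTheory.Balaban1983to89.B5Bounds167Lattice (phi162
  phi162_nonneg)
open Literature.MathematicalPhysics.QuantumFieldTheory.Balaban1983to89.B5Phi162Torus (comp_smul eq_of_comp_eq
  OrthConst dft_comp_zero_of_orthConst orthConst_of_dft_comp_zero dft_const_of_ne LapVinv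
  comp_LapVinv_mulVec PhiOp PhiOp_mulVec PhiInv dft_PhiInv PhiOp_PhiInv_of_orthConst
  orthConst_PhiInv_mulVec phi162_sOf_pos)

noncomputable section

variable {d : ℕ}

/-! ## §1 Scalar tools on a torus `Tor N`: Fourier multipliers, the zero mode, constants -/

section Scalar

variable (N : Fin d → ℕ) [hN : ∀ ν, NeZero (N ν)]

/-- `Σ_x f(x) = 0 ↔ f̃(0) = 0` («orthogonal to constant functions» = no zero Fourier mode).
[folklore] -/
theorem sum_eq_zero_iff_dft_zero (f : Tor N → ℂ) : ∑ x, f x = 0 ↔ (dft N *ᵥ f) 0 = 0 := by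
  have hT : (cT N : ℂ) ≠ 0 := by
    have h : (0 : ℝ) < cT N := by unfold cT; positivity
    exact_mod_cast h.ne'
  rw [dft_zero_apply]
  constructor
  · intro h
    rw [h, mul_zero]
  · intro h
    exact (mul_eq_zero.mp h).resolve_left hT

/-- a scalar FOURIER MULTIPLIER operator `U* diag(m) U` (the shape of `Δ⁻¹`, `(∂₁*φ⁻¹∂₁)⁻¹`).
[folklore] -/
def sMul (m : Tor N → ℂ) : Matrix (Tor N) (Tor N) ℂ := (dft N)ᴴ * Matrix.diagonal m * dft N

/-- `(sMul m f)~(p) = m(p) f̃(p)`. [folklore] -/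
theorem dft_sMul (m : Tor N → ℂ) (f : Tor N → ℂ) (p : Tor N) :
    (dft N *ᵥ (sMul N m *ᵥ f)) p = m p * (dft N *ᵥ f) p := by
  rw [sMul, Matrix.mulVec_mulVec, ← Matrix.mul_assoc, ← Matrix.mul_assoc, dft_mul_conjTranspose,
    Matrix.one_mul, ← Matrix.mulVec_mulVec, Matrix.mulVec_diagonal]

/-- the symbol of `∂_ν` vanishes at `p = 0`: `∂_ν(0) = 0`. [folklore] -/
theorem ssym_zero (c : ℂ) (ν : Fin d) : ssym N c ν 0 = 0 := by
  simp [ssym]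

/-- `∂^*∂ = Δ` applied: `∂*(∂s) = Δs`. [folklore] -/
theorem divS_GradOp_mulVec (c : ℂ) (s : Tor N → ℂ) :
    (GradOp N c)ᴴ *ᵥ (GradOp N c *ᵥ s) = LapS N c *ᵥ s := by
  rw [Matrix.mulVec_mulVec, GradOp_conjTranspose_mul_GradOp]

/-- a gradient has no constant part: `∂t ⊥ constants` componentwise (`Σ_y (∂_μ t)(y) = 0`).
[folklore] -/
theorem orthConst_GradOp (c : ℂ) (t : Tor N → ℂ) : OrthConst N (GradOp N c *ᵥ t) :=
  orthConst_of_dft_comp_zero N fun μ => by rw [dft_comp_GradOp, ssym_zero, zero_mul]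

/-- the CONSTANT CONFIGURATION with components `c_μ` («B₀ is a constant configuration»).
[cite: Balaban1984PropagatorsI, p.27 before (1.58)] -/
def constV (c : Fin d → ℂ) : Tor N × Fin d → ℂ := fun i => c i.2

/-- `∂*A₀ = 0` for a constant configuration `A₀`. [folklore] -/
theorem divS_constV (c₀ : ℂ) (c : Fin d → ℂ) : (GradOp N c₀)ᴴ *ᵥ constV N c = 0 := by
  rw [GradOp_conjTranspose_mulVec_eq]
  funext y
  simp only [divS, Finset.sum_apply, sdiff_conjTranspose_mulVec, comp, constV, sub_self, mul_zero,
    Finset.sum_const_zero, Pi.zero_apply]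

/-- `OrthConst` is preserved under subtraction. [folklore] -/
theorem orthConst_sub {u v : Tor N × Fin d → ℂ} (hu : OrthConst N u) (hv : OrthConst N v) :
    OrthConst N (u - v) := by
  intro μ
  simp only [Pi.sub_apply, Finset.sum_sub_distrib, hu μ, hv μ, sub_self]

end Scalar

variable (n : ℕ) [NeZero n] (M : Fin d → ℕ) [hM : ∀ μ, NeZero (M μ)]

/-! ## §2 Vector-field tools on the double torus: the symbol of `Δ`, the decomposition `B = B′ + B₀` -/

/-- `(ΔA)~_κ(p) = Δ(p) Ã_κ(p)` for the componentwise `Δ = Σ_ν∇_ν*∇_ν` (`B5Prop11Lower.Lap`).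
[cite: Balaban1984PropagatorsI, (1.21) p.21, (1.31) p.23] -/
theorem dft_comp_Lap (A : Tor (fine n M) × Fin d → ℂ) (κ : Fin d) (p : Tor (fine n M)) :
    (dft (fine n M) *ᵥ comp (fine n M) (Lap n M *ᵥ A) κ) p
      = lsym (fine n M) (n : ℂ) p * (dft (fine n M) *ᵥ comp (fine n M) A κ) p := by
  rw [← B5DeltaA169.dftV_mulVec_apply, ← B5DeltaA169.dftV_mulVec_apply, Lap_eq_LapV,
    Matrix.mulVec_mulVec, dftV_mul_LapV, ← Matrix.mulVec_mulVec, Matrix.mulVec_diagonal]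
  rfl

/-- `ΔΔ⁻¹V = V` for a vector field `V ⊥ constants` (componentwise `B5LaplaceInverse`; the law `hG`
of pv15's abstract `Laws`). [cite: Balaban1984PropagatorsI, Sect. C p.22 «by Δ⁻¹ we denote its
inverse on this subspace»] -/
theorem Lap_LapVinv_of_orthConst {V : Tor (fine n M) × Fin d → ℂ} (hV : OrthConst (fine n M) V) :
    Lap n M *ᵥ (LapVinv n M *ᵥ V) = V := by
  have hnc : (n : ℂ) ≠ 0 := by exact_mod_cast NeZero.ne n
  refine eq_of_comp_eq (fine n M) fun κ => dft_mulVec_injective (fine n M) ?_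
  funext p
  show (dft (fine n M) *ᵥ comp (fine n M) (Lap n M *ᵥ (LapVinv n M *ᵥ V)) κ) p
    = (dft (fine n M) *ᵥ comp (fine n M) V κ) p
  rw [dft_comp_Lap, comp_LapVinv_mulVec, dft_LapSinv_apply]
  by_cases hp : p = 0
  · subst hp
    rw [dft_comp_zero_of_orthConst (fine n M) hV κ, mul_zero, mul_zero]
  · have hl : lsym (fine n M) (n : ℂ) p ≠ 0 := fun h => hp ((lsym_eq_zero_iff (fine n M) hnc p).mp h)
    rw [← mul_assoc, mul_inv_cancel₀ hl, one_mul]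

/-- `∂*Δ⁻¹ = Δ⁻¹∂*` (both are Fourier multipliers; the law `hcomm` of pv15's abstract `Laws`).
[folklore] -/
theorem divS_LapVinv (V : Tor (fine n M) × Fin d → ℂ) :
    (GradOp (fine n M) (n : ℂ))ᴴ *ᵥ (LapVinv n M *ᵥ V)
      = LapSinv (fine n M) (n : ℂ) *ᵥ ((GradOp (fine n M) (n : ℂ))ᴴ *ᵥ V) := by
  refine dft_mulVec_injective (fine n M) ?_
  funext p
  show (dft (fine n M) *ᵥ ((GradOp (fine n M) (n : ℂ))ᴴ *ᵥ (LapVinv n M *ᵥ V))) p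
    = (dft (fine n M) *ᵥ (LapSinv (fine n M) (n : ℂ) *ᵥ ((GradOp (fine n M) (n : ℂ))ᴴ *ᵥ V))) p
  rw [dft_GradOp_adjoint, dft_LapSinv_apply, dft_GradOp_adjoint, Finset.mul_sum]
  refine Finset.sum_congr rfl fun ν _ => ?_
  rw [comp_LapVinv_mulVec, dft_LapSinv_apply]
  ring

/-- `Δ∂ = ∂Δ`: the componentwise Laplace operator commutes with the gradient. [folklore] -/
theorem Lap_GradOp_mulVec (s : Tor (fine n M) → ℂ) :
    Lap n M *ᵥ (GradOp (fine n M) (n : ℂ) *ᵥ s)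
      = GradOp (fine n M) (n : ℂ) *ᵥ (LapS (fine n M) (n : ℂ) *ᵥ s) := by
  refine eq_of_comp_eq (fine n M) fun κ => dft_mulVec_injective (fine n M) ?_
  funext p
  show (dft (fine n M) *ᵥ comp (fine n M) (Lap n M *ᵥ (GradOp (fine n M) (n : ℂ) *ᵥ s)) κ) p
    = (dft (fine n M) *ᵥ comp (fine n M) (GradOp (fine n M) (n : ℂ) *ᵥ (LapS (fine n M) (n : ℂ) *ᵥ s)) κ) p
  rw [dft_comp_Lap, dft_comp_GradOp, dft_comp_GradOp, dft_LapS_apply]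
  ring

/-- `∂*∂·∂ = (Δ − ∂∂*)∂ = 0`: gradients carry no curvature (the law `hdd` «∂∂ = 0» of pv15's
abstract `Laws`, in the form needed for the quadratic form `⟨A, ∂*∂A⟩`; `(Δ − ∂∂*) = ∂*∂` is (1.69)).
[folklore] -/
theorem DstarD_GradOp_mulVec (s : Tor (fine n M) → ℂ) :
    DstarD n M *ᵥ (GradOp (fine n M) (n : ℂ) *ᵥ s) = 0 := by
  rw [DstarD, Matrix.sub_mulVec, ← Matrix.mulVec_mulVec, divS_GradOp_mulVec, Lap_GradOp_mulVec,
    sub_self]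

/-- «A₀ = Q_k*B₀»: for a constant configuration `B₀` on the unit lattice, `Q_k*B₀` is THE CONSTANT
CONFIGURATION ON `T_η` WITH THE SAME COMPONENTS (at a fine bond, `Q_k*B` is the average of `B` over
the `n` block bonds whose averaging lines pass through it). [cite: Balaban1984PropagatorsI, p.27 before (1.58)] -/
theorem QvAdj_constV (c : Fin d → ℂ) : QvAdj n M *ᵥ constV M c = constV (fine n M) c := by
  have hnc : (n : ℂ) ≠ 0 := by exact_mod_cast NeZero.ne n
  funext ⟨x, κ⟩
  rw [QvAdj_mulVec, Pi.smul_apply, QvOp_adjoint_mulVec, smul_eq_mul]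
  simp only [constV, Finset.sum_const, Finset.card_univ, Fintype.card_fin, nsmul_eq_mul]
  field_simp
  ring

/-- «Q_kA₀ = B₀»: `Q_k` of a constant configuration on `T_η` is the constant configuration with the
same components on the unit lattice. [cite: Balaban1984PropagatorsI, p.27 before (1.58), (1.18) p.20] -/
theorem QvOp_constV (c : Fin d → ℂ) : QvOp n M *ᵥ constV (fine n M) c = constV M c := by
  have hnc : (n : ℂ) ≠ 0 := by exact_mod_cast NeZero.ne n
  funext ⟨y, μ⟩
  rw [QvOp_mulVec]
  simp only [lineSum, constV, Finset.sum_const, Finset.card_univ, Fintype.card_fin, Fintype.card_pi,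
    Finset.prod_const, nsmul_eq_mul]
  push_cast
  field_simp
  ring

/-- `ΔA₀ = 0` for a constant configuration `A₀` (componentwise `Δ`). [folklore] -/
theorem Lap_constV (c : Fin d → ℂ) : Lap n M *ᵥ constV (fine n M) c = 0 := by
  refine eq_of_comp_eq (fine n M) fun κ => dft_mulVec_injective (fine n M) ?_
  funext p
  show (dft (fine n M) *ᵥ comp (fine n M) (Lap n M *ᵥ constV (fine n M) c) κ) p
    = (dft (fine n M) *ᵥ comp (fine n M) (0 : Tor (fine n M) × Fin d → ℂ) κ) p
  have h0 : comp (fine n M) (0 : Tor (fine n M) × Fin d → ℂ) κ = 0 := rfl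
  rw [dft_comp_Lap, h0, Matrix.mulVec_zero, Pi.zero_apply]
  by_cases hp : p = 0
  · rw [hp, lsym_zero, zero_mul]
  · have hc : comp (fine n M) (constV (fine n M) c) κ = fun _ => c κ := rfl
    rw [hc, dft_const_of_ne (fine n M) (c κ) hp, mul_zero]

/-- `∂*∂A₀ = (Δ − ∂∂*)A₀ = 0` for a constant configuration `A₀`. [folklore] -/
theorem DstarD_constV (c : Fin d → ℂ) : DstarD n M *ᵥ constV (fine n M) c = 0 := by
  rw [DstarD, Matrix.sub_mulVec, ← Matrix.mulVec_mulVec, divS_constV, Matrix.mulVec_zero, Lap_constV,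
    sub_zero]

/-- `Q_k*u ⊥ constants` (componentwise, on `T_η`) whenever `u ⊥ constants` on the unit lattice — the
zero mode of `Q_k*u` is `n^d c_Q` times the zero mode of `u` (`B5Adjoint176.dft_QvOp_adjoint` at
`p = 0`). [folklore] -/
theorem orthConst_QvAdj {u : Tor M × Fin d → ℂ} (hu : OrthConst M u) :
    OrthConst (fine n M) (QvAdj n M *ᵥ u) :=
  orthConst_of_dft_comp_zero (fine n M) fun κ => by
    rw [← B5FiberZero.pOf_zero n M, QvAdj_mulVec, comp_smul, Matrix.mulVec_smul, Pi.smul_apply,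
      smul_eq_mul, dft_QvOp_adjoint, sOf_zero, dft_comp_zero_of_orthConst M hu κ, mul_zero, mul_zero]

/-- `B₀`: the constant part of `B` — the orthogonal projection onto the constant configurations,
component by component (`(B₀)_μ = |T₁|⁻¹ Σ_y B_μ(y)`). [cite: Balaban1984PropagatorsI, p.27 «Taking
the decomposition B = B′ + B₀, where B₀ is a constant configuration and B′ is in the orthogonal
subspace»] -/
def B0 (B : Tor M × Fin d → ℂ) : Tor M × Fin d → ℂ :=
  constV M fun μ => ((Fintype.card (Tor M) : ℂ))⁻¹ * ∑ y, B (y, μ)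

/-- `B′ = B − B₀`. [cite: Balaban1984PropagatorsI, p.27 before (1.58)] -/
def Bp (B : Tor M × Fin d → ℂ) : Tor M × Fin d → ℂ := B - B0 M B

/-- «B′ is in the orthogonal subspace»: `Σ_y B′_μ(y) = 0`. [cite: Balaban1984PropagatorsI, p.27] -/
theorem orthConst_Bp (B : Tor M × Fin d → ℂ) : OrthConst M (Bp M B) := by
  have hc : ((Fintype.card (Tor M) : ℂ)) ≠ 0 := Nat.cast_ne_zero.mpr Fintype.card_ne_zero
  intro μ
  simp only [Bp, B0, constV, Pi.sub_apply, Finset.sum_sub_distrib, Finset.sum_const, Finset.card_univ,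
    nsmul_eq_mul]
  rw [← mul_assoc, mul_inv_cancel₀ hc, one_mul, sub_self]

/-- `B = B′ + B₀`. [cite: Balaban1984PropagatorsI, p.27 before (1.58)] -/
theorem Bp_add_B0 (B : Tor M × Fin d → ℂ) : Bp M B + B0 M B = B := by
  rw [Bp, sub_add_cancel]

/-- the orthogonal projection `P₀` onto constant configurations as a matrix (`P₀B = B₀`). [folklore] -/
def P0M : Matrix (Tor M × Fin d) (Tor M × Fin d) ℂ :=
  fun i j => if i.2 = j.2 then ((Fintype.card (Tor M) : ℂ))⁻¹ else 0

/-- `P₀B = B₀`. [folklore] -/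
theorem P0M_mulVec (B : Tor M × Fin d → ℂ) : P0M M *ᵥ B = B0 M B := by
  funext ⟨y, μ⟩
  simp only [Matrix.mulVec, dotProduct, P0M, B0, constV, Fintype.sum_prod_type, ite_mul, zero_mul,
    Finset.sum_ite_eq, Finset.mem_univ, if_true, Finset.mul_sum]

/-- «Q_kA₀ = B₀ … A₀ = Q_k*B₀»: `Q_k(Q_k*B₀) = B₀` (the law `hQB₀` of pv15's abstract `Laws`; note
`Q_kQ_k* ≠ I` in general — the identity holds on constant configurations).
[cite: Balaban1984PropagatorsI, p.27 before (1.58)] -/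
theorem QvOp_QvAdj_B0 (B : Tor M × Fin d → ℂ) : QvOp n M *ᵥ (QvAdj n M *ᵥ B0 M B) = B0 M B := by
  rw [B0, QvAdj_constV, QvOp_constV]

/-- `∂*(Q_k*B₀) = 0` (the law `hB₀d`/`h155s` instance of pv15's abstract `Laws`). [folklore] -/
theorem divS_QvAdj_B0 (B : Tor M × Fin d → ℂ) :
    (GradOp (fine n M) (n : ℂ))ᴴ *ᵥ (QvAdj n M *ᵥ B0 M B) = 0 := by
  rw [B0, QvAdj_constV, divS_constV]

/-- `∂*∂(Q_k*B₀) = 0` (the law `hB₀c` «∂(Q_k*B₀) = 0» of pv15's abstract `Laws`, in quadratic-form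
shape). [folklore] -/
theorem DstarD_QvAdj_B0 (B : Tor M × Fin d → ℂ) : DstarD n M *ᵥ (QvAdj n M *ᵥ B0 M B) = 0 := by
  rw [B0, QvAdj_constV, DstarD_constV]

/-! ## §3 (1.55) and its adjoint; `Q′_k*` and `(Q′_kΔ⁻²Q′_k*)⁻¹` with the (1.21) weights -/

/-- **(1.55) «Q_k∂ = ∂₁Q′_k, ∂₁ is the unit lattice differentiation»** for the typed operators
(`B5Block118.QvOp_gaugeT_eq` at `A = 0`). [cite: Balaban1984PropagatorsI, (1.55) p.27] -/
theorem QvOp_GradOp_mulVec (s : Tor (fine n M) → ℂ) :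
    QvOp n M *ᵥ (GradOp (fine n M) (n : ℂ) *ᵥ s) = GradOp M 1 *ᵥ (QsOp n M *ᵥ s) := by
  have h := QvOp_gaugeT_eq n M 0 s
  simp only [gaugeT, zero_sub, Matrix.mulVec_neg, Matrix.mulVec_zero, neg_inj] at h
  exact h

/-- `Q′_k*`: the adjoint of `Q′_k` for the weighted scalar products (1.21) (`⟨f, g⟩_{T_η} = Σ η^d f̄g`,
`⟨·,·⟩_{T₁}` unweighted): `Q′_k* = η^{-d}(Q′_k)ᴴ = n^d(Q′_k)ᴴ`. [cite: Balaban1984PropagatorsI, (1.21) p.21] -/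
def QsAdj : Matrix (Tor (fine n M)) (Tor M) ℂ := ((n : ℂ) ^ d) • (QsOp n M)ᴴ

/-- **the adjoint of (1.55): `∂*Q_k* = Q′_k*∂₁*`** (the law `h155s` of pv15's abstract `Laws`).
[cite: Balaban1984PropagatorsI, (1.55) p.27, (1.21) p.21] -/
theorem divS_QvAdj (u : Tor M × Fin d → ℂ) :
    (GradOp (fine n M) (n : ℂ))ᴴ *ᵥ (QvAdj n M *ᵥ u) = QsAdj n M *ᵥ ((GradOp M 1)ᴴ *ᵥ u) := by
  have hm : QvOp n M * GradOp (fine n M) (n : ℂ) = GradOp M 1 * QsOp n M :=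
    Matrix.toLin'.injective (LinearMap.ext fun s => by
      rw [Matrix.toLin'_apply, Matrix.toLin'_apply, ← Matrix.mulVec_mulVec, ← Matrix.mulVec_mulVec,
        QvOp_GradOp_mulVec])
  have h := congrArg Matrix.conjTranspose hm
  rw [Matrix.conjTranspose_mul, Matrix.conjTranspose_mul] at h
  rw [QvAdj_mulVec, Matrix.mulVec_smul, Matrix.mulVec_mulVec, h, ← Matrix.mulVec_mulVec, QsAdj,
    Matrix.smul_mulVec]

/-- `(Q′_kΔ⁻²Q′_k*)⁻¹` on the subspace orthogonal to constants, with the (1.21) weights: since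
`B5Substitution125.Mop = Q′_kΔ⁻²(Q′_k)ᴴ`, the printed `Q′_kΔ⁻²Q′_k* = n^d·Mop` and its inverse is
`n^{-d}·Minv`. [cite: Balaban1984PropagatorsI, Sect. C p.22, (1.60) p.28] -/
def Einv : Matrix (Tor M) (Tor M) ℂ := ((n : ℂ) ^ d)⁻¹ • Minv n M (n : ℂ)

/-- the weights cancel in the product: `Q′_k*(Q′_kΔ⁻²Q′_k*)⁻¹ = (Q′_k)ᴴ·Minv`. [folklore] -/
theorem QsAdj_Einv (t : Tor M → ℂ) : QsAdj n M *ᵥ (Einv n M *ᵥ t) = (QsOp n M)ᴴ *ᵥ (Minv n M (n : ℂ) *ᵥ t) := by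
  have hnd : ((n : ℂ) ^ d) ≠ 0 := pow_ne_zero _ (by exact_mod_cast NeZero.ne n)
  rw [QsAdj, Einv, Matrix.smul_mulVec, Matrix.smul_mulVec, Matrix.mulVec_smul, smul_smul,
    mul_inv_cancel₀ hnd, one_smul]

/-- `(Q′_kΔ⁻²Q′_k*)·(Q′_kΔ⁻²Q′_k*)⁻¹t = t` for `t ⊥ constants` (the law `hEr` of pv15's abstract
`Laws`; `B5Substitution125.Mop_Minv_of_orth`). [cite: Balaban1984PropagatorsI, Sect. C p.22] -/
theorem QsOp_LapSinv2_QsAdj_Einv (t : Tor M → ℂ) (ht : ∑ y, t y = 0) :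
    QsOp n M *ᵥ (LapSinv (fine n M) (n : ℂ) *ᵥ (LapSinv (fine n M) (n : ℂ) *ᵥ
      (QsAdj n M *ᵥ (Einv n M *ᵥ t)))) = t := by
  have hnc : (n : ℂ) ≠ 0 := by exact_mod_cast NeZero.ne n
  rw [QsAdj_Einv, ← Mop_mulVec, Mop_Minv_of_orth n M (n : ℂ) hnc t ht]

/-! ## §4 The printed `(∂₁*φ⁻¹∂₁)⁻¹`, `λ′`, `ω`, and the solvability condition `∂₁*ω = 0` -/

/-- `∂₁*φ⁻¹∂₁` on unit-lattice scalars (`φ⁻¹ = B5Phi162Torus.PhiInv`, the printed `φ⁻¹` on the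
subspace orthogonal to constants). [cite: Balaban1984PropagatorsI, p.27 «λ′ = (∂₁*φ⁻¹∂₁)⁻¹∂₁*φ⁻¹B′»] -/
def GPhi : Matrix (Tor M) (Tor M) ℂ := (GradOp M 1)ᴴ * PhiInv n M * GradOp M 1

/-- the symbol of `∂₁*φ⁻¹∂₁`: `g(p′) = Σ_μ |∂¹_μ(p′)|² φ_μ(p′)⁻¹` (value `0` at `p′ = 0`).
[cite: Balaban1984PropagatorsI, (1.62) p.28, (1.66) p.29] -/
def gsym (q : Tor M) : ℂ :=
  ∑ μ, conj (ssym M 1 μ q) * ssym M 1 μ q * ((((phi162 n μ (sOf M q) : ℝ)) : ℂ))⁻¹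

omit [NeZero n] in
/-- `(∂₁*φ⁻¹∂₁t)~(p′) = g(p′) t̃(p′)`. [cite: Balaban1984PropagatorsI, (1.62) p.28] -/
theorem dft_GPhi (t : Tor M → ℂ) (q : Tor M) :
    (dft M *ᵥ (GPhi n M *ᵥ t)) q = gsym n M q * (dft M *ᵥ t) q := by
  rw [GPhi, ← Matrix.mulVec_mulVec, ← Matrix.mulVec_mulVec, dft_GradOp_adjoint, gsym, Finset.sum_mul]
  refine Finset.sum_congr rfl fun μ _ => ?_
  rw [dft_PhiInv, dft_comp_GradOp]
  ring

omit [NeZero n] in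
/-- `g(0) = 0`. [folklore] -/
theorem gsym_zero : gsym n M 0 = 0 := by
  simp [gsym, ssym_zero]

omit [NeZero n] in
/-- `g(p′)` is (the cast of) the non-negative real `Σ_μ |∂¹_μ(p′)|² φ_μ(p′)⁻¹`. [folklore] -/
theorem gsym_eq_ofReal (q : Tor M) :
    gsym n M q = ((∑ μ, ‖ssym M 1 μ q‖ ^ 2 * (phi162 n μ (sOf M q))⁻¹ : ℝ) : ℂ) := by
  rw [gsym, Complex.ofReal_sum]
  refine Finset.sum_congr rfl fun μ _ => ?_
  rw [Complex.conj_mul' (ssym M 1 μ q)]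
  push_cast
  ring

/-- **`g(p′) ≠ 0` for `p′ ≠ 0`**: some `∂¹_μ(p′) ≠ 0` (`Δ¹(p′) ≠ 0`, `B5Momentum130.lsym_eq_zero_iff`)
and every `φ_μ(p′) > 0` (pv15 `phi162_pos`, the printed «0 < γ₀ ≦ Δ₀(p′)φ_μ(p′)»).
[cite: Balaban1984PropagatorsI, p.28 after (1.62)] -/
theorem gsym_ne_zero {q : Tor M} (hq : q ≠ 0) : gsym n M q ≠ 0 := by
  have hn : 1 ≤ n := Nat.one_le_iff_ne_zero.mpr (NeZero.ne n)
  obtain ⟨μ₀, hμ₀⟩ : ∃ μ, ssym M 1 μ q ≠ 0 := by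
    by_contra h
    push Not at h
    apply hq
    apply (lsym_eq_zero_iff M one_ne_zero q).mp
    simp only [lsym, h, mul_zero, Finset.sum_const_zero]
  have hpos : ∀ μ, 0 ≤ ‖ssym M 1 μ q‖ ^ 2 * (phi162 n μ (sOf M q))⁻¹ := fun μ =>
    mul_nonneg (sq_nonneg _) (inv_nonneg.mpr (phi162_nonneg n μ _))
  have hlt : 0 < ∑ μ, ‖ssym M 1 μ q‖ ^ 2 * (phi162 n μ (sOf M q))⁻¹ :=
    lt_of_lt_of_le (mul_pos (by positivity) (inv_pos.mpr (phi162_sOf_pos n M hn μ₀ hq)))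
      (Finset.single_le_sum (fun μ _ => hpos μ) (Finset.mem_univ μ₀))
  rw [gsym_eq_ofReal]
  exact_mod_cast hlt.ne'

/-- **`(∂₁*φ⁻¹∂₁)⁻¹`** on the subspace orthogonal to constants: the scalar Fourier multiplier
`g(p′)⁻¹` (value `0` at `p′ = 0`). [cite: Balaban1984PropagatorsI, p.27 «λ′ = (∂₁*φ⁻¹∂₁)⁻¹∂₁*φ⁻¹B′»,
(1.60) p.28] -/
def GPhiInv : Matrix (Tor M) (Tor M) ℂ := sMul M fun q => (gsym n M q)⁻¹

/-- `(∂₁*φ⁻¹∂₁)(∂₁*φ⁻¹∂₁)⁻¹t = t` for `t ⊥ constants` («This equation can be solved with respect to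
λ′»). [cite: Balaban1984PropagatorsI, p.27 before (1.59)] -/
theorem GPhi_GPhiInv_of_orth (t : Tor M → ℂ) (ht : ∑ y, t y = 0) :
    GPhi n M *ᵥ (GPhiInv n M *ᵥ t) = t := by
  refine dft_mulVec_injective M ?_
  funext q
  show (dft M *ᵥ (GPhi n M *ᵥ (GPhiInv n M *ᵥ t))) q = (dft M *ᵥ t) q
  rw [dft_GPhi, GPhiInv, dft_sMul]
  by_cases hq : q = 0
  · subst hq
    rw [(sum_eq_zero_iff_dft_zero M t).mp ht, mul_zero, mul_zero]
  · rw [← mul_assoc, mul_inv_cancel₀ (gsym_ne_zero n M hq), one_mul]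

omit [NeZero n] in
/-- `(∂₁*φ⁻¹∂₁)⁻¹t ⊥ constants` for every `t`. [folklore] -/
theorem sum_GPhiInv (t : Tor M → ℂ) : ∑ y, (GPhiInv n M *ᵥ t) y = 0 := by
  rw [sum_eq_zero_iff_dft_zero, GPhiInv, dft_sMul, gsym_zero, inv_zero, zero_mul]

/-- **`λ′ = (∂₁*φ⁻¹∂₁)⁻¹∂₁*φ⁻¹B′`**, `B′ = B − B₀`. [cite: Balaban1984PropagatorsI, p.27 before (1.59)] -/
def Lam (B : Tor M × Fin d → ℂ) : Tor M → ℂ :=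
  GPhiInv n M *ᵥ ((GradOp M 1)ᴴ *ᵥ (PhiInv n M *ᵥ Bp M B))

omit [NeZero n] in
/-- `λ′ ⊥ constants`. [folklore] -/
theorem sum_Lam (B : Tor M × Fin d → ℂ) : ∑ y, Lam n M B y = 0 :=
  sum_GPhiInv n M _

/-- `B″ := B′ − ∂₁λ′`, the field under `φ⁻¹` after regrouping (1.59)/(1.60). [folklore] -/
def Bpp (B : Tor M × Fin d → ℂ) : Tor M × Fin d → ℂ := Bp M B - GradOp M 1 *ᵥ Lam n M B

omit [NeZero n] in
/-- `B″ ⊥ constants` (`B′` is, and a gradient is). [folklore] -/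
theorem orthConst_Bpp (B : Tor M × Fin d → ℂ) : OrthConst M (Bpp n M B) :=
  orthConst_sub M (orthConst_Bp M B) (orthConst_GradOp M 1 _)

/-- **THE NORMAL EQUATION for `λ′`: `∂₁*φ⁻¹(B′ − ∂₁λ′) = 0`**, i.e. the printed solvability condition
«∂₁*ω = ∂₁*φ⁻¹∂₁λ′ − ∂₁*φ⁻¹B′ = 0» holds for `λ′ = (∂₁*φ⁻¹∂₁)⁻¹∂₁*φ⁻¹B′` (the law `hΛ` of pv15's
abstract `Laws`; `∂₁*φ⁻¹B′ ⊥ constants` by `B5DivOrth.sum_divS`).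
[cite: Balaban1984PropagatorsI, p.27 before (1.59)] -/
theorem normal_eq (B : Tor M × Fin d → ℂ) :
    (GradOp M 1)ᴴ *ᵥ (PhiInv n M *ᵥ Bpp n M B) = 0 := by
  have ht : ∑ y, ((GradOp M 1)ᴴ *ᵥ (PhiInv n M *ᵥ Bp M B)) y = 0 := by
    rw [GradOp_conjTranspose_mulVec_eq]
    exact sum_divS M 1 _
  have h2 : (GradOp M 1)ᴴ *ᵥ (PhiInv n M *ᵥ (GradOp M 1 *ᵥ Lam n M B))
      = GPhi n M *ᵥ (GPhiInv n M *ᵥ ((GradOp M 1)ᴴ *ᵥ (PhiInv n M *ᵥ Bp M B))) := by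
    rw [Lam, GPhi, ← Matrix.mulVec_mulVec, ← Matrix.mulVec_mulVec]
  rw [Bpp, Matrix.mulVec_sub, Matrix.mulVec_sub, h2, GPhi_GPhiInv_of_orth n M _ ht, sub_self]

/-- the printed Lagrange multiplier «ω = + φ⁻¹∂₁λ′ − φ⁻¹B′» (a field on the unit lattice).
[cite: Balaban1984PropagatorsI, p.27 after (1.58)] -/
def omegaW (B : Tor M × Fin d → ℂ) : Tor M × Fin d → ℂ :=
  PhiInv n M *ᵥ (GradOp M 1 *ᵥ Lam n M B) - PhiInv n M *ᵥ Bp M B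

omit [NeZero n] in
/-- `ω = −φ⁻¹B″`. [folklore] -/
theorem omegaW_eq (B : Tor M × Fin d → ℂ) : omegaW n M B = -(PhiInv n M *ᵥ Bpp n M B) := by
  rw [omegaW, Bpp, Matrix.mulVec_sub]
  abel

/-- **«The solvability condition gives the equation ∂₁*ω = ∂₁*φ⁻¹∂₁λ′ − ∂₁*φ⁻¹B′ = 0»** — it holds
for the printed `λ′`. [cite: Balaban1984PropagatorsI, p.27 after (1.58)] -/
theorem divS1_omegaW (B : Tor M × Fin d → ℂ) : (GradOp M 1)ᴴ *ᵥ omegaW n M B = 0 := by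
  rw [omegaW_eq, Matrix.mulVec_neg, normal_eq, neg_zero]

/-- **(1.57) «−Q_kΔ⁻¹Q_k*ω + ∂₁λ′ + Q_kA₀ = B»** holds with the printed `ω = φ⁻¹∂₁λ′ − φ⁻¹B′`,
`λ′`, and `A₀ = Q_k*B₀` ((1.58): `Q_kΔ⁻¹Q_k* = φ`, `φφ⁻¹ = I` on `B″ ⊥ constants`).
[cite: Balaban1984PropagatorsI, (1.57)–(1.58) p.27] -/
theorem eq157 (B : Tor M × Fin d → ℂ) :
    -(QvOp n M *ᵥ (LapVinv n M *ᵥ (QvAdj n M *ᵥ omegaW n M B))) + GradOp M 1 *ᵥ Lam n M B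
      + QvOp n M *ᵥ (QvAdj n M *ᵥ B0 M B) = B := by
  rw [← PhiOp_mulVec, omegaW_eq, Matrix.mulVec_neg, neg_neg,
    PhiOp_PhiInv_of_orthConst n M (Nat.one_le_iff_ne_zero.mpr (NeZero.ne n)) (orthConst_Bpp n M B), QvOp_QvAdj_B0, Bpp, Bp]
  abel

/-! ## §5 THE TYPED (1.59) AND (1.60) -/

/-- `θ := Δ⁻²Q′_k*(Q′_kΔ⁻²Q′_k*)⁻¹λ′`, the fine scalar under `∂` in (1.59)/(1.60) (pv15's abstract
`OpData.ω`; not the printed multiplier `ω`, which is `omegaW`). [cite: Balaban1984PropagatorsI, (1.60) p.28] -/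
def theta (B : Tor M × Fin d → ℂ) : Tor (fine n M) → ℂ :=
  LapSinv (fine n M) (n : ℂ) *ᵥ (LapSinv (fine n M) (n : ℂ) *ᵥ (QsAdj n M *ᵥ (Einv n M *ᵥ Lam n M B)))

/-- `A* := Δ⁻¹Q_k*φ⁻¹B″`, `B″ = B′ − ∂₁λ′` — the first term of (1.59). [cite: Balaban1984PropagatorsI, (1.59) p.28] -/
def Astar (B : Tor M × Fin d → ℂ) : Tor (fine n M) × Fin d → ℂ :=
  LapVinv n M *ᵥ (QvAdj n M *ᵥ (PhiInv n M *ᵥ Bpp n M B))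

/-- **(1.59) TYPED**: «A = Δ⁻¹Q_k*(φ⁻¹B′ − φ⁻¹∂₁(∂₁*φ⁻¹∂₁)⁻¹∂₁*φ⁻¹B′)
+ ∂Δ⁻²Q′_k*(Q′_kΔ⁻²Q′_k*)⁻¹(∂₁*φ⁻¹∂₁)⁻¹∂₁*φ⁻¹B′ + Q_k*B₀» with `λ′ = (∂₁*φ⁻¹∂₁)⁻¹∂₁*φ⁻¹B′ = Lam B`.
[cite: Balaban1984PropagatorsI, (1.59) p.28] -/
def H159 (B : Tor M × Fin d → ℂ) : Tor (fine n M) × Fin d → ℂ :=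
  LapVinv n M *ᵥ (QvAdj n M *ᵥ (PhiInv n M *ᵥ Bp M B - PhiInv n M *ᵥ (GradOp M 1 *ᵥ Lam n M B)))
    + GradOp (fine n M) (n : ℂ) *ᵥ theta n M B
    + QvAdj n M *ᵥ B0 M B

/-- **(1.60) TYPED, verbatim grouping**: «H_kB = Δ⁻¹Q_k*φ⁻¹B′ + [∂Δ⁻²Q′_k*(Q′_kΔ⁻²Q′_k*)⁻¹ −
Δ⁻¹Q_k*φ⁻¹∂₁](∂₁*φ⁻¹∂₁)⁻¹∂₁*φ⁻¹B′ + Q_k*B₀» — the bracket applied to `λ′ = (∂₁*φ⁻¹∂₁)⁻¹∂₁*φ⁻¹B′`.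
[cite: Balaban1984PropagatorsI, (1.60) p.28] -/
def H160 (B : Tor M × Fin d → ℂ) : Tor (fine n M) × Fin d → ℂ :=
  LapVinv n M *ᵥ (QvAdj n M *ᵥ (PhiInv n M *ᵥ Bp M B))
    + (GradOp (fine n M) (n : ℂ) *ᵥ theta n M B
        - LapVinv n M *ᵥ (QvAdj n M *ᵥ (PhiInv n M *ᵥ (GradOp M 1 *ᵥ Lam n M B))))
    + QvAdj n M *ᵥ B0 M B

/-- «This defines the operator H_kB = A, thus we have» (1.60): `H159 = H160` (linearity).
[cite: Balaban1984PropagatorsI, (1.59)–(1.60) p.28] -/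
theorem H159_eq_H160 (B : Tor M × Fin d → ℂ) : H159 n M B = H160 n M B := by
  simp only [H159, H160, Matrix.mulVec_sub]
  abel

/-- regrouping by linearity: `H_kB = A* + ∂θ + Q_k*B₀`. [folklore] -/
theorem H160_eq (B : Tor M × Fin d → ℂ) :
    H160 n M B = Astar n M B + GradOp (fine n M) (n : ℂ) *ᵥ theta n M B + QvAdj n M *ᵥ B0 M B := by
  simp only [H160, Astar, Bpp, Matrix.mulVec_sub]
  abel

/-- `∂*A* = 0`: `∂*Δ⁻¹Q_k*φ⁻¹B″ = Δ⁻¹Q′_k*·∂₁*φ⁻¹B″ = 0` by the normal equation. [folklore] -/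
theorem divS_Astar (B : Tor M × Fin d → ℂ) : (GradOp (fine n M) (n : ℂ))ᴴ *ᵥ Astar n M B = 0 := by
  rw [Astar, divS_LapVinv, divS_QvAdj, normal_eq, Matrix.mulVec_zero, Matrix.mulVec_zero]

/-- `Q_kA* = B″` by (1.58) (`Q_kΔ⁻¹Q_k* = φ`, `φφ⁻¹B″ = B″`, `B″ ⊥ constants`). [folklore] -/
theorem QvOp_Astar (B : Tor M × Fin d → ℂ) : QvOp n M *ᵥ Astar n M B = Bpp n M B := by
  rw [Astar, ← PhiOp_mulVec, PhiOp_PhiInv_of_orthConst n M (Nat.one_le_iff_ne_zero.mpr (NeZero.ne n)) (orthConst_Bpp n M B)]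

/-- `ΔA* = Q_k*φ⁻¹B″` (`Q_k*φ⁻¹B″ ⊥ constants`). [folklore] -/
theorem Lap_Astar (B : Tor M × Fin d → ℂ) :
    Lap n M *ᵥ Astar n M B = QvAdj n M *ᵥ (PhiInv n M *ᵥ Bpp n M B) :=
  Lap_LapVinv_of_orthConst n M (orthConst_QvAdj n M (orthConst_PhiInv_mulVec n M (Nat.one_le_iff_ne_zero.mpr (NeZero.ne n)) _))

/-! ## §6 «Using (1.60) … we can verify all the properties of H_kB» — the three p.29 properties -/

/-- **(i) `Q_kH_kB = B` for (1.60)**: `Q_kA* = B′ − ∂₁λ′`, `Q_k∂θ = ∂₁Q′_kθ = ∂₁λ′` ((1.55),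
`Q′_kΔ⁻²Q′_k*(Q′_kΔ⁻²Q′_k*)⁻¹λ′ = λ′`), `Q_kQ_k*B₀ = B₀`, and `B′ + B₀ = B`.
[cite: Balaban1984PropagatorsI, p.29 «Q_kH_kB = B»] -/
theorem QvOp_H160 (B : Tor M × Fin d → ℂ) : QvOp n M *ᵥ H160 n M B = B := by
  rw [H160_eq, Matrix.mulVec_add, Matrix.mulVec_add, QvOp_Astar, QvOp_GradOp_mulVec, theta,
    QsOp_LapSinv2_QsAdj_Einv n M _ (sum_Lam n M B), QvOp_QvAdj_B0, Bpp, Bp]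
  abel

/-- **(ii), first half: `∂*H_kB = Δ⁻¹Q′_k*(Q′_kΔ⁻²Q′_k*)⁻¹λ′`** (`∂*A* = 0`, `∂*∂Δ⁻² = Δ⁻¹` on the
range of `Δ⁻¹`, `∂*Q_k*B₀ = 0`). [cite: Balaban1984PropagatorsI, p.29 «R∂*H_kB = 0»] -/
theorem divS_H160 (B : Tor M × Fin d → ℂ) :
    (GradOp (fine n M) (n : ℂ))ᴴ *ᵥ H160 n M B
      = LapSinv (fine n M) (n : ℂ) *ᵥ (QsAdj n M *ᵥ (Einv n M *ᵥ Lam n M B)) := by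
  rw [H160_eq, Matrix.mulVec_add, Matrix.mulVec_add, divS_Astar, zero_add, theta, divS_GradOp_mulVec,
    LapS_LapSinv_LapSinv, divS_QvAdj_B0, add_zero]

/-- **(ii) `R∂*H_kB = 0` for (1.60)**, `R = I − P`, `P = Δ⁻¹Q′_kᴴ(Q′_kΔ⁻²Q′_kᴴ)⁻¹Q′_kΔ⁻¹`
(`B5Value126.PcT`): `P` fixes `Δ⁻¹Q′_kᴴ·Minv·λ′` ((1.38)). [cite: Balaban1984PropagatorsI, p.29
«R∂*H_kB = 0», (1.38) p.24] -/
theorem R_divS_H160 (B : Tor M × Fin d → ℂ) :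
    (1 - PcT n M (n : ℂ)) *ᵥ ((GradOp (fine n M) (n : ℂ))ᴴ *ᵥ H160 n M B) = 0 := by
  have hnc : (n : ℂ) ≠ 0 := by exact_mod_cast NeZero.ne n
  rw [divS_H160, QsAdj_Einv, Matrix.sub_mulVec, Matrix.one_mulVec, PcT_mulVec, ← Mop_mulVec,
    Mop_Minv_of_orth n M (n : ℂ) hnc _ (sum_Lam n M B), sub_self]

/-- **`∂*∂H_kB = Q_k*φ⁻¹(B′ − ∂₁λ′)`** for (1.60) (`∂*∂∂θ = 0`, `∂*∂Q_k*B₀ = 0`, `∂*∂A* = ΔA* − ∂∂*A* = ΔA*`).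
[cite: Balaban1984PropagatorsI, (1.59) p.28, (1.69) p.29 «Δ = ∂*∂ + ∂∂*»] -/
theorem DstarD_H160 (B : Tor M × Fin d → ℂ) :
    DstarD n M *ᵥ H160 n M B = QvAdj n M *ᵥ (PhiInv n M *ᵥ Bpp n M B) := by
  rw [H160_eq, Matrix.mulVec_add, Matrix.mulVec_add, DstarD_GradOp_mulVec, add_zero, DstarD_QvAdj_B0,
    add_zero, DstarD, Matrix.sub_mulVec, ← Matrix.mulVec_mulVec, divS_Astar, Matrix.mulVec_zero, sub_zero,
    Lap_Astar]

/-- **«which means that ⟨∂A′, ∂H_kB⟩ = 0 on the subspace {A′ : Q_kA′ = 0, …}»** for (1.60) — indeed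
for every `A′` with `Q_kA′ = 0`: `⟨A′, ∂*∂H_kB⟩ = ⟨A′, Q_k*φ⁻¹B″⟩ = n^d⟨Q_kA′, φ⁻¹B″⟩ = 0`.
[cite: Balaban1984PropagatorsI, p.29 (text)] -/
theorem form_DstarD_H160_eq_zero (B : Tor M × Fin d → ℂ) (A' : Tor (fine n M) × Fin d → ℂ)
    (hA' : QvOp n M *ᵥ A' = 0) : star A' ⬝ᵥ (DstarD n M *ᵥ H160 n M B) = 0 := by
  have hnd : (((n : ℂ) ^ d))⁻¹ ≠ 0 := inv_ne_zero (pow_ne_zero _ (by exact_mod_cast NeZero.ne n))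
  have h := QvAdj_adjoint n M A' (PhiInv n M *ᵥ Bpp n M B)
  rw [hA', star_zero, zero_dotProduct] at h
  rw [DstarD_H160]
  exact (mul_eq_zero.mp h.symm).resolve_left hnd

/-- the Pythagorean identity: for `Q_kA = B`,
`⟨A, ∂*∂A⟩ = ⟨A − H_kB, ∂*∂(A − H_kB)⟩ + ⟨H_kB, ∂*∂H_kB⟩`. [folklore] -/
theorem form_DstarD_decomp_H160 (B : Tor M × Fin d → ℂ) (A : Tor (fine n M) × Fin d → ℂ)
    (hA : QvOp n M *ᵥ A = B) :
    star A ⬝ᵥ (DstarD n M *ᵥ A)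
      = star (A - H160 n M B) ⬝ᵥ (DstarD n M *ᵥ (A - H160 n M B))
        + star (H160 n M B) ⬝ᵥ (DstarD n M *ᵥ H160 n M B) := by
  set H := H160 n M B with hH
  have hA' : QvOp n M *ᵥ (A - H) = 0 := by
    rw [Matrix.mulVec_sub, hA, hH, QvOp_H160, sub_self]
  have h1 : star (A - H) ⬝ᵥ (DstarD n M *ᵥ H) = 0 := form_DstarD_H160_eq_zero n M B (A - H) hA'
  have h2 : star H ⬝ᵥ (DstarD n M *ᵥ (A - H)) = 0 := by
    rw [Matrix.star_dotProduct, star_mulVec_dotProduct, DstarD_conjTranspose, h1, star_zero]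
  have e : A = (A - H) + H := (sub_add_cancel A H).symm
  conv_lhs => rw [e]
  rw [star_add, Matrix.mulVec_add, add_dotProduct, dotProduct_add, dotProduct_add, h1, h2, add_zero,
    zero_add]

/-- **(iii) `H_kB` of (1.60) minimises `⟨A, ∂*∂A⟩ = ½Σ|F_{μν}[A]|²` among all `A` with `Q_kA = B`**
(a fortiori on the printed hyperplane). [cite: Balaban1984PropagatorsI, p.29 «H_kB is a minimum of
½⟨∂A, ∂A⟩ on the hyperplane {A : Q_kA = B, R∂*A = 0}»] -/
theorem H160_minimum (B : Tor M × Fin d → ℂ) (A : Tor (fine n M) × Fin d → ℂ)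
    (hA : QvOp n M *ᵥ A = B) : cEnergy n M (H160 n M B) ≤ cEnergy n M A := by
  have hnn := cEnergy_nonneg n M (A - H160 n M B)
  unfold cEnergy at hnn ⊢
  rw [form_DstarD_decomp_H160 n M B A hA, Complex.add_re]
  linarith

/-- **THE p.29 SENTENCE FOR (1.60)**: the torus data of `B5HkPropsTorus.hkDataTorus` with `H := H160`
(the typed (1.60)) satisfy the typed verbatim statement `B5.HkPropsPrinted` — «Q_kH_kB = B, R∂*H_kB = 0,
H_kB is a minimum of ½⟨∂A, ∂A⟩ on the hyperplane {A : Q_kA = B, R∂*A = 0}».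
[cite: Balaban1984PropagatorsI, p.29 «Using (1.60), or better (1.63), we can verify all the properties
of H_kB» (proof ours, the (1.60) branch)] -/
theorem hkPropsPrinted_H160 : HkPropsPrinted { hkDataTorus n M with H := H160 n M } := by
  intro B
  refine ⟨QvOp_H160 n M B, R_divS_H160 n M B, ?_⟩
  intro A hA _
  change (1 / 2 : ℝ) * cEnergy n M (H160 n M B) ≤ (1 / 2 : ℝ) * cEnergy n M A
  exact mul_le_mul_of_nonneg_left (H160_minimum n M B A hA) (by norm_num)

/-! ## §7 (1.60) = (1.63) -/

/-- **(1.60) = (1.63) ON THE DOUBLE TORUS**: the x-space operator (1.60) and the tree's momentum-space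
operator (1.63) (`B5Hk163Torus.HkOp`) coincide, `H160 n M B = HkOp n M *ᵥ B` for every `B` — both
satisfy the p.29 sentence, which determines `H_k` (`B5HkPropsTorus.eq_HkOp_of_hkPropsPrinted`).
[cite: Balaban1984PropagatorsI, p.28 «Let us write this operator in momentum representation. … We have
the following momentum representation for H_kB:» (1.63); proof ours (uniqueness, not the symbol
computation)] -/
theorem H160_eq_HkOp (B : Tor M × Fin d → ℂ) : H160 n M B = HkOp n M *ᵥ B :=
  eq_HkOp_of_hkPropsPrinted n M (H160 n M) (hkPropsPrinted_H160 n M) B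

/-- (1.59) = (1.63) likewise. [cite: Balaban1984PropagatorsI, (1.59) p.28, (1.63) p.28] -/
theorem H159_eq_HkOp (B : Tor M × Fin d → ℂ) : H159 n M B = HkOp n M *ᵥ B := by
  rw [H159_eq_H160, H160_eq_HkOp]

/-- **«H_kB is a minimum … on the hyperplane {A : Q_kA = B, R∂*A = 0}» — AND THE ONLY ONE**, for
(1.60): a field of the printed hyperplane whose energy does not exceed that of `H_kB` is `H_kB`
(`B5Hk163RDiv.HkOp_minimum_unique`; the gauge condition removes the degeneracy `A ↦ A + ∂λ`).
[cite: Balaban1984PropagatorsI, p.29 (text); proof ours] -/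
theorem H160_unique (B : Tor M × Fin d → ℂ) (A : Tor (fine n M) × Fin d → ℂ) (hA : QvOp n M *ᵥ A = B)
    (hR : (1 - PcT n M (n : ℂ)) *ᵥ ((GradOp (fine n M) (n : ℂ))ᴴ *ᵥ A) = 0)
    (hle : cEnergy n M A ≤ cEnergy n M (H160 n M B)) : A = H160 n M B := by
  rw [H160_eq_HkOp] at hle ⊢
  exact HkOp_minimum_unique n M B A hA hR hle

/-- (1.60) AS A MATRIX («This defines the operator H_k»): every ingredient is a matrix and `B ↦ B′`,
`B ↦ B₀` are `I − P₀`, `P₀`. [cite: Balaban1984PropagatorsI, (1.60) p.28] -/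
def H160M : Matrix (Tor (fine n M) × Fin d) (Tor M × Fin d) ℂ :=
  LapVinv n M * QvAdj n M * PhiInv n M * (1 - P0M M)
    + (GradOp (fine n M) (n : ℂ) * LapSinv (fine n M) (n : ℂ) * LapSinv (fine n M) (n : ℂ) * QsAdj n M
          * Einv n M
        - LapVinv n M * QvAdj n M * PhiInv n M * GradOp M 1)
      * GPhiInv n M * (GradOp M 1)ᴴ * PhiInv n M * (1 - P0M M)
    + QvAdj n M * P0M M

/-- the matrix (1.60) acts as `H160`. [folklore] -/
theorem H160M_mulVec (B : Tor M × Fin d → ℂ) : H160M n M *ᵥ B = H160 n M B := by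
  simp only [H160M, H160, theta, Lam, Bp, Matrix.add_mulVec, Matrix.sub_mul, Matrix.sub_mulVec,
    Matrix.one_mulVec, ← Matrix.mulVec_mulVec, P0M_mulVec]

/-- **(1.60) = (1.63) AS OPERATORS**: `H160M n M = B5Hk163Torus.HkOp n M`.
[cite: Balaban1984PropagatorsI, (1.60) p.28, (1.63) p.28; proof ours] -/
theorem H160M_eq_HkOp : H160M n M = HkOp n M :=
  Matrix.toLin'.injective (LinearMap.ext fun B => by
    rw [Matrix.toLin'_apply, Matrix.toLin'_apply, H160M_mulVec, H160_eq_HkOp])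

end

end Literature.MathematicalPhysics.QuantumFieldTheory.Balaban1983to89.B5Hk160Torus
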